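import Summits.QuantumFields.YangMills.Theorems.SwapVirialDeficitNearFlatTube
import Summits.QuantumFields.YangMills.Theorems.SwapVirialDeficitNearFlatBridge
import Summits.QuantumFields.YangMills.Theorems.UnitScaleTiltFluctuationComparisonRegPrFibreLocalInverse
import HarnessLib

/-!
# LEADER SIDE OF THE (S-B) FAR FLOOR: in the capped B-tube every B-letter is LINEARLY controlled by the relations — no smallness threshold
# (free-hands support of ⟨stmt-QuantumFields-24197⟩ `SwapVirialDeficit.SwapGluedStiffness`; ➎ ruling of record memo9 «the B-tube needs an axial cap»; input of the
# hypothesis `hfar` of w2 g59's ✓`bTube_fibred_scaled_cylinder(_uniform)` on `BTubeCap`)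

Leaders of the σ-glued chart: hub `c` (unit), `C₀` (unit, `t₀ = ‖im C₀‖`), the SLAVED `C₁ = c̄·C₀·c·Z` (`Z` the unit of the slaving letter), `C₂` (unit).  Two identities do all the work:
* §1 ★★ `sq_norm_comm_conj` (ANY `c, C₀`, no unit hypothesis):  `‖C₀(c̄C₀c) − (c̄C₀c)C₀‖² = 16·(t₀²·(re c)² + ⟪im c, im C₀⟫²)·(t₀²‖im c‖² − ⟪im c, im C₀⟫²)`
  — in the letters of ✓`…NearFlatSigmaWords` with the axis `v = im C₀/t₀`: `= 16 t₀⁴·P·Q`, `P` the A-weight of the seam (hub-polar² + axial²), `Q` its B-weight;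
* §2 ★ `norm_sigmaWord_slaved` (unit `c, C₀`): `‖c·C₁ − C₀·c‖ = ‖Z − 1‖` — the first σ-word IS the slaving letter.
Hence (§3) ★★★ `tube_letters_le`: if `t₀ ≥ τ₁ > 0` (the heavy leader is non-central) and `t₀²·Q ≥ q₀·t₀²`, `q₀ > 0` (the CAP: the transverse part of `C₀`'s axis
relative to the hub is bounded below — on `BTubeCap` with `|x₀| ≤ X₁√(1+|u|²)`, `|u| ≥ τ`, `|δ| ≤ δ₁` one has `q₀ = τ²/((1+δ₁²)(X₁²(1+τ²)+τ²))`), and the four relations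
`‖[C₀,C₁]‖, ‖[C₀,C₂]‖, ‖cC₁ − C₀c‖, ‖cC₂ − C₂c‖ ≤ m`, then WITHOUT ANY SMALLNESS CONDITION ON `m`:
    `‖Z − 1‖ ≤ m`,   `16·q₀·τ₁²·(t₀²(re c)² + ⟪im c, im C₀⟫²) ≤ 9m²`   (hub-polar letter `δ` AND axial letter),   `4·q₀·‖im C₂‖² ≤ (m + 2m/τ₁)²`
(the last through ✓`exists_coaxial_near` at the heavy `C₀` and ✓`sq_norm_comm_coax_unit`).  With ✓`relations_le_of_chartDeficit` (`m = 60L³√F̂/√2`) this is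
`‖y‖_B² ≤ K(τ, X₁)·L⁶·F̂` on the capped tube, i.e. the far floor `F̂ ≥ R²/(K L⁶)` for `‖y‖_B ≥ R` — the letters transfer is the consumer's (w2 / w3-successor).
Why the cap is needed (memo9): at fixed `|u| ≥ τ` and `x₀ → ∞` the configuration approaches stratum A (`Q → 0`) and `F̂ → 0` although `‖y‖_B → ∞`.

HONEST LABEL: elementary quaternion algebra; stubs B ∕ core-tip ∕ core-end ∕ 001 of skeleton ➎ v6, ⟨24197⟩ ∕ ⟨24194⟩ ∕ ⟨24497⟩ OPEN; own crux ⟨22884⟩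
`LargeFieldMassRefinementTail` OPEN (blocked-on ⟨19935⟩); the Yang–Mills mass gap is NOT proved; no summit is proved by a line.  THEOREMS ONLY (0 `def`, 0 `sorry`),
standard axioms.  LEAD seat ym-line-sfw-p2 g99 (cell ym-idea-1, free hands), `--supports stmt-QuantumFields-24197`.  References: [folklore].
-/

set_option autoImplicit false

noncomputable section

open Quaternion
open scoped Quaternion RealInnerProductSpace
open Literature.MathematicalPhysics.QuantumFieldTheory.DybalskiStottmeisterTanimoto2024.DST24CriticalPoint (inner_eq_components)
open Literature.MathematicalPhysics.QuantumLattice (sq_norm_eq_sum_sq)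
open Summit.QuantumFields.YangMills.Theorems.VirialFluxGap.AnchorSlice (norm_coe_add_smul_pure_sq)

namespace Summit.QuantumFields.YangMills.Theorems.SwapVirialDeficit.NearFlat

/-! ## §1 The conjugate-commutator identity -/

/-- ★★ **THE CONJUGATE-COMMUTATOR IDENTITY** (any `c, C₀ : ℍ`): `‖C₀(c̄C₀c) − (c̄C₀c)C₀‖² = 16·(‖im C₀‖²(re c)² + ⟪im c, im C₀⟫²)·(‖im C₀‖²‖im c‖² − ⟪im c, im C₀⟫²)`
(`⟨b, c̄bc⟩ = t₀²((re c)² − ‖im c‖²) + 2⟪im c, b⟫²` and Lagrange). [folklore] -/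
theorem sq_norm_comm_conj (c C₀ : ℍ) :
    ‖C₀ * (star c * C₀ * c) - (star c * C₀ * c) * C₀‖ ^ 2 =
      16 * (‖C₀.im‖ ^ 2 * c.re ^ 2 + ⟪c.im, C₀.im⟫ ^ 2) * (‖C₀.im‖ ^ 2 * ‖c.im‖ ^ 2 - ⟪c.im, C₀.im⟫ ^ 2) := by
  rw [sq_norm_eq_sum_sq, sq_norm_eq_sum_sq C₀.im, sq_norm_eq_sum_sq c.im, inner_eq_components]
  simp only [Quaternion.re_im, Quaternion.imI_im, Quaternion.imJ_im, Quaternion.imK_im,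
    Quaternion.re_sub, Quaternion.imI_sub, Quaternion.imJ_sub, Quaternion.imK_sub,
    Quaternion.re_mul, Quaternion.imI_mul, Quaternion.imJ_mul, Quaternion.imK_mul,
    Quaternion.re_star, Quaternion.imI_star, Quaternion.imJ_star, Quaternion.imK_star]
  ring

/-! ## §2 The slaved leader and the first σ-word -/

/-- ★ **THE FIRST σ-WORD IS THE SLAVING LETTER**: for unit `c, C₀` and any `Z`, `‖c·(c̄C₀cZ) − C₀·c‖ = ‖Z − 1‖`. [folklore] -/
theorem norm_sigmaWord_slaved {c C₀ : ℍ} (hc : ‖c‖ = 1) (hC₀ : ‖C₀‖ = 1) (Z : ℍ) :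
    ‖c * (star c * C₀ * c * Z) - C₀ * c‖ = ‖Z - 1‖ := by
  have e : c * (star c * C₀ * c * Z) - C₀ * c = C₀ * c * (Z - 1) := by
    rw [mul_sub, mul_one, ← mul_assoc, ← mul_assoc, ← mul_assoc, Summit.QuantumFields.YangMills.Theorems.FibreLocalInverse.self_mul_star_of_norm_eq_one hc, one_mul]
  rw [e, norm_mul, norm_mul, hC₀, hc, one_mul, one_mul]

/-- The slaved leader is within `‖Z − 1‖` of the plain conjugate `c̄C₀c` (unit `c, C₀`). [folklore] -/
theorem norm_slaved_sub_conj {c C₀ : ℍ} (hc : ‖c‖ = 1) (hC₀ : ‖C₀‖ = 1) (Z : ℍ) :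
    ‖star c * C₀ * c * Z - star c * C₀ * c‖ = ‖Z - 1‖ := by
  have e : star c * C₀ * c * Z - star c * C₀ * c = star c * C₀ * c * (Z - 1) := by rw [mul_sub, mul_one]
  rw [e, norm_mul, norm_mul, norm_mul, Quaternion.norm_star, hc, hC₀, one_mul, one_mul, one_mul]

/-! ## §3 The capped tube: every B-letter is linear in the relations -/

/-- ★★★ **THE CAPPED TUBE IS LINEARLY CONTROLLED BY THE RELATIONS** (no smallness threshold).  Unit hub `c`, unit leaders `C₀, C₂`, unit slaving letter `Z`,
`C₁ = c̄C₀cZ`; the heavy leader non-central (`τ₁ ≤ ‖im C₀‖`) and the CAP `q₀·t₀² ≤ t₀²‖im c‖² − ⟪im c, im C₀⟫²` (transverse part of `C₀`'s axis relative to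
the hub bounded below); relations `≤ m`.  Then the slaving letter, the hub-polar + axial weight, and the centrality of `C₂` are all `O(m)`:
`‖Z − 1‖ ≤ m`, `16 q₀ τ₁² (t₀²(re c)² + ⟪im c, im C₀⟫²) ≤ 9m²`, `4 q₀ ‖im C₂‖² ≤ (m + 2m/τ₁)²`. [folklore] -/
theorem tube_letters_le {c C₀ C₂ Z : ℍ} (hc : ‖c‖ = 1) (hC₀ : ‖C₀‖ = 1) (hC₂ : ‖C₂‖ = 1) (hZ : ‖Z‖ = 1) {τ₁ q₀ m : ℝ}
    (hτ : 0 < τ₁) (ht₀ : τ₁ ≤ ‖C₀.im‖) (hq : 0 < q₀) (hQ : q₀ * ‖C₀.im‖ ^ 2 ≤ ‖C₀.im‖ ^ 2 * ‖c.im‖ ^ 2 - ⟪c.im, C₀.im⟫ ^ 2)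
    (h01 : ‖C₀ * (star c * C₀ * c * Z) - (star c * C₀ * c * Z) * C₀‖ ≤ m) (h02 : ‖C₀ * C₂ - C₂ * C₀‖ ≤ m)
    (hs0 : ‖c * (star c * C₀ * c * Z) - C₀ * c‖ ≤ m) (hs2 : ‖c * C₂ - C₂ * c‖ ≤ m) :
    ‖Z - 1‖ ≤ m ∧ 16 * q₀ * τ₁ ^ 2 * (‖C₀.im‖ ^ 2 * c.re ^ 2 + ⟪c.im, C₀.im⟫ ^ 2) ≤ 9 * m ^ 2 ∧
      4 * q₀ * ‖C₂.im‖ ^ 2 ≤ (m + 2 * (m / τ₁)) ^ 2 := by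
  have hm0 : 0 ≤ m := le_trans (norm_nonneg _) hs2
  have ht₀0 : 0 < ‖C₀.im‖ := hτ.trans_le ht₀
  have hne : C₀.im ≠ 0 := norm_pos_iff.1 ht₀0
  -- (Z)
  have hZ1 : ‖Z - 1‖ ≤ m := by rw [← norm_sigmaWord_slaved hc hC₀ Z]; exact hs0
  -- (P): the plain conjugate commutator is within `2‖Z − 1‖` of `[C₀, C₁]`
  have hcomm : ‖C₀ * (star c * C₀ * c) - (star c * C₀ * c) * C₀‖ ≤ 3 * m := by
    have hB : ‖star c * C₀ * c * Z‖ ≤ 1 := by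
      rw [norm_mul, norm_mul, norm_mul, Quaternion.norm_star, hc, hC₀, hZ]; norm_num
    have h := comm_lipschitz (A := C₀) (B := star c * C₀ * c * Z) (A' := C₀) (B' := star c * C₀ * c) (by rw [hC₀]) hB
    rw [sub_self, norm_zero, mul_zero, add_zero, norm_slaved_sub_conj hc hC₀ Z] at h
    linarith
  have hP : 16 * q₀ * τ₁ ^ 2 * (‖C₀.im‖ ^ 2 * c.re ^ 2 + ⟪c.im, C₀.im⟫ ^ 2) ≤ 9 * m ^ 2 := by
    have hsq : ‖C₀ * (star c * C₀ * c) - (star c * C₀ * c) * C₀‖ ^ 2 ≤ (3 * m) ^ 2 := pow_le_pow_left₀ (norm_nonneg _) hcomm 2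
    rw [sq_norm_comm_conj] at hsq
    have hA0 : 0 ≤ ‖C₀.im‖ ^ 2 * c.re ^ 2 + ⟪c.im, C₀.im⟫ ^ 2 := by positivity
    have hqt : q₀ * τ₁ ^ 2 ≤ ‖C₀.im‖ ^ 2 * ‖c.im‖ ^ 2 - ⟪c.im, C₀.im⟫ ^ 2 := by
      have h1 : q₀ * τ₁ ^ 2 ≤ q₀ * ‖C₀.im‖ ^ 2 := mul_le_mul_of_nonneg_left (pow_le_pow_left₀ hτ.le ht₀ 2) hq.le
      exact h1.trans hQ
    nlinarith [mul_le_mul_of_nonneg_left hqt hA0]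
  -- (C₂): coaxialize at the heavy `C₀`, then the commutator word of a coaxial element
  have hC2 : 4 * q₀ * ‖C₂.im‖ ^ 2 ≤ (m + 2 * (m / τ₁)) ^ 2 := by
    obtain ⟨C₂', hre, ⟨t, ht⟩, hnorm, -, hdist⟩ := exists_coaxial_near hne C₂
    -- the move and the transferred word
    have hd : ‖C₂ - C₂'‖ ≤ m / τ₁ := by
      calc ‖C₂ - C₂'‖ ≤ ‖C₀ * C₂ - C₂ * C₀‖ / ‖C₀.im‖ := hdist
        _ ≤ m / ‖C₀.im‖ := div_le_div_of_nonneg_right h02 ht₀0.le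
        _ ≤ m / τ₁ := div_le_div_of_nonneg_left hm0 hτ ht₀
    have hC₂'1 : ‖C₂'‖ = 1 := norm_eq_one_of_sq (by rw [hnorm, hC₂, one_pow])
    have hw : ‖c * C₂' - C₂' * c‖ ≤ m + 2 * (m / τ₁) := by
      have h := comm_lipschitz (A := c) (B := C₂) (A' := c) (B' := C₂') (by rw [hc]) (by rw [hC₂])
      rw [sub_self, norm_zero, mul_zero, add_zero] at h
      linarith
    -- the coax letters of `C₂'` on the unit axis `v = im C₀/t₀`
    obtain ⟨e, hrt⟩ := coax_letters_of_im_eq_smul (Quaternion.re_im C₀) hne hC₂'1 ht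
    have hv : (‖C₀.im‖⁻¹ • C₀.im).re = 0 := by rw [Quaternion.re_smul, Quaternion.re_im, smul_zero]
    have hv1 : ‖(‖C₀.im‖⁻¹ • C₀.im)‖ = 1 := by rw [norm_smul, norm_inv, norm_norm, inv_mul_cancel₀ ht₀0.ne']
    have hword := sq_norm_comm_coax_unit hv hv1 c C₂'.re (t * ‖C₀.im‖)
    rw [← e] at hword
    -- `Q_v = (t₀²‖im c‖² − ⟪im c, im C₀⟫²)/t₀² ≥ q₀`, and `‖im C₂‖ = ‖im C₂'‖ = |t|·t₀`
    have hQv : q₀ ≤ ‖c.im‖ ^ 2 - ⟪c.im, ‖C₀.im‖⁻¹ • C₀.im⟫ ^ 2 := by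
      rw [inner_smul_right, mul_pow, inv_pow]
      have h1 : ‖c.im‖ ^ 2 - (‖C₀.im‖ ^ 2)⁻¹ * ⟪c.im, C₀.im⟫ ^ 2 = (‖C₀.im‖ ^ 2 * ‖c.im‖ ^ 2 - ⟪c.im, C₀.im⟫ ^ 2) / ‖C₀.im‖ ^ 2 := by
        field_simp
      rw [h1, le_div_iff₀ (by positivity)]
      exact hQ
    have him : ‖C₂.im‖ ^ 2 = (t * ‖C₀.im‖) ^ 2 := by
      have h1 : ‖C₂'.im‖ ^ 2 = (t * ‖C₀.im‖) ^ 2 := by rw [ht, norm_smul, Real.norm_eq_abs, mul_pow, sq_abs, mul_pow]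
      have h2 : ‖C₂.im‖ ^ 2 = ‖C₂'.im‖ ^ 2 := by
        have e1 : ‖C₂‖ ^ 2 = C₂.re ^ 2 + ‖C₂.im‖ ^ 2 := by
          rw [sq_norm_eq_sum_sq C₂, sq_norm_eq_sum_sq C₂.im, Quaternion.re_im, Quaternion.imI_im, Quaternion.imJ_im, Quaternion.imK_im]; ring
        have e2 : ‖C₂'‖ ^ 2 = C₂'.re ^ 2 + ‖C₂'.im‖ ^ 2 := by
          rw [sq_norm_eq_sum_sq C₂', sq_norm_eq_sum_sq C₂'.im, Quaternion.re_im, Quaternion.imI_im, Quaternion.imJ_im, Quaternion.imK_im]; ring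
        rw [hre] at e2; linarith [hnorm]
      rw [h2, h1]
    have hwsq : ‖c * C₂' - C₂' * c‖ ^ 2 ≤ (m + 2 * (m / τ₁)) ^ 2 := pow_le_pow_left₀ (norm_nonneg _) hw 2
    rw [hword] at hwsq
    rw [him]
    have ht2 : 0 ≤ (t * ‖C₀.im‖) ^ 2 := sq_nonneg _
    nlinarith [mul_le_mul_of_nonneg_left hQv ht2]
  exact ⟨hZ1, hP, hC2⟩

end Summit.QuantumFields.YangMills.Theorems.SwapVirialDeficit.NearFlat

end
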